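/-
Copyright (c) 2026. All rights reserved.
Released under Apache 2.0 license as described in the file LICENSE.
Authors: abc-iut cell, discharge seat abc-iut-w4-d095 (wave 4, gen 3).
-/
import Literature.AnabelianGeometry.AbsoluteAnabelian.LogFrobeniusLogWallIndependence
import Literature.AnabelianGeometry.AbsoluteAnabelian.LogFrobeniusObservables
import HarnessLib

/-!
# [AbsTopIII] Corollary 5.5 (iii) `TS`-half and (iv) PRINT-FAITHFUL log-wall at the DIAGONAL setting: `S_log` exists, `Cor55LogWall` FAILS — with `LogFrobeniusLogWallTSNonVacuity.lean`, the print-faithful log-wall is INDEPENDENT of the interface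

S. Mochizuki, *Topics in absolute anabelian geometry III: global reconstruction algorithms*,
J. Math. Sci. Univ. Tokyo 22 (2015) 939–1156 [MochizukiAbsTopIII2015]; locators `p.N` = pages of the
author's manuscript (`paper:url-5493eb38cbb7`): Def 3.5 (ii), (iii) pp. 75–76, Def 5.4 (vii) p. 128, Cor 5.5 (iii), (iv) p. 131.

PROOF companion of `LogFrobeniusObservables.lean` (abc-iut-L4-t3: `TSHomotopies`, `IsLogObservableTS`, `Cor55ObservablesTS`, the
print-faithful `Cor55LogWall T`) continuing this seat's `LogFrobeniusLogWallIndependence.lean` (p427401: the diagonal setting, its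
strict-commutation families, `diagonal_isCore_core`, `diagonal_isLogObservablePlus`, `diagonalObsFamily_compatibleIn`).  Contents:

* `LogFrobeniusSetting.diagonalTS` — the `TS`-valued `ι_{v,ε}` of Def 5.4 (vii) for the diagonal setting: the identity identifications
  `(Λ_ν ∘ 𝟭) ∘ 𝟭 = 𝟭 ∘ 𝟭` at EVERY arrow of `Γ⃗^log_v` (the witness used anonymously in p423782, now named), `iota_toTS` by
  whiskering an `eqToHom`.
* `LogFrobeniusSetting.diagonal_isLogObservableTS` / `diagonal_cor55ObservablesTS` — the typed Cor 5.5 (iii) `TS`-half HOLDS at the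
  diagonal setting: the strict commutations of the pairs of paths ending at `𝒩_v` on the portion of `D•_{≤3}` indexed by `v` form
  `S_log`, their prescribed homotopies being the `ι_{v,ε}` (both `eqToHom`s).
* `LogFrobeniusSetting.diagonal_not_cor55LogWall` — the typed PRINT-FAITHFUL Cor 5.5 (iv), first sentence, FAILS at the diagonal
  setting: core on `D•_{≤1} ∪ {□}`, the `⊞`-observables, the `TS`-observables and the ambient strict-commutation family of `D•⊢` are
  pairwise compatible.  Together with `LogFrobeniusSetting.exists_cor55LogWall` (`LogFrobeniusLogWallTSNonVacuity.lean`: the log-wall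
  HOLDS at explicit settings over every nonempty index set) this is the kernel INDEPENDENCE of the print-faithful log-wall from the
  interface `LogFrobeniusSetting` + `TSHomotopies` — it carries genuine content (Lemma 3.4 / Lemma 4.4) and is correctly a hypothesis.

HONEST LABEL: calibration of typed statements only; the diagonal setting is degenerate (no arithmetic content).  Refereed pre-IUT
anabelian geometry; nothing here bears on [IUTchIII] Cor. 3.12; typed ≠ proved.
-/

universe u

open CategoryTheory Quiver

namespace Literature.AnabelianGeometry.AbsoluteAnabelian

namespace LogFrobeniusSetting

section Lemmas

variable {C : Type (u + 1)} [Category.{u} C]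

/-- `(Λ_ν ∘ 𝟭) ∘ 𝟭 = 𝟭 ∘ 𝟭` for `log = 𝟭`. [cite: MochizukiAbsTopIII2015, Def 5.4 (vii) p. 128] -/
private theorem twist_id_comp_id_comp_id (b : Bool) : (frobeniusTwist (𝟭 C) b ⋙ 𝟭 C) ⋙ 𝟭 C = 𝟭 C ⋙ 𝟭 C := by
  cases b <;> rfl

/-- Whiskering an `eqToHom` of functors on the right is an `eqToHom`. [folklore] -/
private theorem whiskerRight_eqToHom'' {A B B' : Type*} [Category A] [Category B] [Category B'] {F G : A ⥤ B}
    (h : F = G) (R : B ⥤ B') :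
    Functor.whiskerRight (eqToHom h) R = eqToHom (show F ⋙ R = G ⋙ R by rw [h]) := by
  subst h
  rw [eqToHom_refl, Functor.whiskerRight_id', eqToHom_refl]

/-- A chain of three `eqToHom`s is an `eqToHom` (free endpoints, so that it applies up to definitional unfolding). [folklore] -/
private theorem eqToHom_eq_comp₃' {D : Type*} [Category D] {a b c d : D} (p : a = b) (q : b = c) (r : c = d)
    (s : a = d) : eqToHom s = eqToHom p ≫ eqToHom q ≫ eqToHom r := by
  cases p; cases q; cases r; simp

end Lemmas

variable (Vmod : Type u) (isArc : Vmod → Bool) (C : Type (u + 1)) [Category.{u} C]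

/-- **The `TS`-homotopies of the diagonal setting** (Def 5.4 (vii), `TS`-half): at every arrow `ε : ν₁ → ν₂` of `Γ⃗^log_v` the identity
identification `(Λ_{ν₁} ∘ λ_{ν₁}) ∘ (𝒩⊞ → 𝒩) = λ_{ν₂} ∘ (𝒩⊞ → 𝒩)` (all functors being `𝟭 C`); the printed requirement "on `Γ⃗^⋉_v` it is
`ι⊞_{v,ε}` pushed down to `𝒩_v`" holds because whiskering an `eqToHom` is an `eqToHom`.  DEGENERATE by design.
[cite: MochizukiAbsTopIII2015, Def 5.4 (vii) p. 128] -/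
def diagonalTS : (diagonal Vmod isArc C).TSHomotopies where
  iota := fun _ ν₁ _ _ => eqToHom (twist_id_comp_id_comp_id (C := C) ν₁.isPostLog)
  iota_toTS := fun v ν₁ ν₂ ε => by
    change eqToHom _ = Functor.whiskerRight (eqToHom (frobeniusTwist_id_comp_eq C (𝟭 C) ν₁.isPostLog)) (𝟭 C)
    rw [whiskerRight_eqToHom'']

/-- `ι_{v,ε}` of the diagonal `TS`-homotopies is an `eqToHom`, independent of the edge. [cite: MochizukiAbsTopIII2015, Def 5.4 (vii) p. 128] -/
theorem diagonalTS_iota (v : Vmod) {ν₁ ν₂ : LogVertex (isArc v)} (ε : LogEdgeTS (isArc v) ν₁ ν₂) :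
    (diagonalTS Vmod isArc C).iota v ε = eqToHom (twist_id_comp_id_comp_id (C := C) ν₁.isPostLog) := rfl

/-- **The strict commutations form the observable `S_log_v` at the diagonal setting** (Cor 5.5 (iii), `TS`-half, as typed by
`IsLogObservableTS`, on the portion of `D•_{≤3}` indexed by `v` with observation vertex `𝒩_v`): all boundary paths end at `𝒩_v`,
and the prescribed homotopies at `([λ_{ν₁}], [λ_{ν₂}])` and `([λ_{sl}]∘[id_⋎]∘[log], [λ_{ν₂}]∘[id_{⋎+1}])` ARE the `ι_{v,ε}` (both
`eqToHom`s). [cite: MochizukiAbsTopIII2015, Cor 5.5 (iii) p. 131] -/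
theorem diagonal_isLogObservableTS (v : Vmod) :
    (diagonal Vmod isArc C).IsLogObservableTS (diagonalTS Vmod isArc C) v
      (diagonalObsFamily Vmod isArc C (InPortionThree v) (.nv v)) := by
  refine ⟨fun _ _ _ _ h => h, ?_, ?_⟩
  · intro ν₁ ν₂ ε h₁ h₂
    refine ⟨rfl, fun X₀ => ?_⟩
    have hobj : (((diagonal Vmod isArc C).logDiagramTS v).pathFunctor (lamPathTS v ν₁ h₁)).obj X₀ =
        ((frobeniusTwist (diagonal Vmod isArc C).log ν₁.isPostLog ⋙ (diagonal Vmod isArc C).lam v ν₁) ⋙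
          (diagonal Vmod isArc C).forget v).obj X₀ := by
      rw [lamPathTS, DiagramOfCategories.pathFunctor_cons, DiagramOfCategories.pathFunctor_cons,
        DiagramOfCategories.pathFunctor_nil]
      exact (Functor.congr_obj (twist_id_comp_id_comp_id (C := C) ν₁.isPostLog) X₀).symm
    have hobj' : ((diagonal Vmod isArc C).lam v ν₂ ⋙ (diagonal Vmod isArc C).forget v).obj X₀ =
        (((diagonal Vmod isArc C).logDiagramTS v).pathFunctor (lamPathTS v ν₂ h₂)).obj X₀ := by
      rw [lamPathTS, DiagramOfCategories.pathFunctor_cons, DiagramOfCategories.pathFunctor_cons,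
        DiagramOfCategories.pathFunctor_nil]
      rfl
    refine ⟨hobj, hobj', ?_⟩
    change (eqToHom (diagonal_extend_pathFunctor_eq Vmod isArc C _ _ (lamPathTS v ν₁ h₁) (lamPathTS v ν₂ h₂))).app X₀ =
      eqToHom hobj ≫ (eqToHom (twist_id_comp_id_comp_id (C := C) ν₁.isPostLog)).app X₀ ≫ eqToHom hobj'
    simp only [eqToHom_app]
    exact eqToHom_eq_comp₃' _ _ _ _
  · intro ν₁ ν₂ ε h₁ h₂ hsl n
    refine ⟨rfl, fun X₀ => ?_⟩
    have hobj : (((diagonal Vmod isArc C).logDiagramTS v).pathFunctor (postLogDomPathTS v n hsl)).obj X₀ =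
        ((frobeniusTwist (diagonal Vmod isArc C).log ν₁.isPostLog ⋙ (diagonal Vmod isArc C).lam v ν₁) ⋙
          (diagonal Vmod isArc C).forget v).obj X₀ := by
      rw [postLogDomPathTS, DiagramOfCategories.pathFunctor_cons, DiagramOfCategories.pathFunctor_cons,
        DiagramOfCategories.pathFunctor_cons, DiagramOfCategories.pathFunctor_cons, DiagramOfCategories.pathFunctor_nil]
      exact (Functor.congr_obj (twist_id_comp_id_comp_id (C := C) ν₁.isPostLog) X₀).symm
    have hobj' : ((diagonal Vmod isArc C).lam v ν₂ ⋙ (diagonal Vmod isArc C).forget v).obj X₀ =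
        (((diagonal Vmod isArc C).logDiagramTS v).pathFunctor (postLogCodPathTS v n ν₂ h₂)).obj X₀ := by
      rw [postLogCodPathTS, DiagramOfCategories.pathFunctor_cons, DiagramOfCategories.pathFunctor_cons,
        DiagramOfCategories.pathFunctor_cons, DiagramOfCategories.pathFunctor_nil]
      rfl
    refine ⟨hobj, hobj', ?_⟩
    change (eqToHom (diagonal_extend_pathFunctor_eq Vmod isArc C _ _ (postLogDomPathTS v n hsl)
      (postLogCodPathTS v n ν₂ h₂))).app X₀ =
      eqToHom hobj ≫ (eqToHom (twist_id_comp_id_comp_id (C := C) ν₁.isPostLog)).app X₀ ≫ eqToHom hobj'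
    simp only [eqToHom_app]
    exact eqToHom_eq_comp₃' _ _ _ _

/-- **Cor 5.5 (iii), `TS`-half, HOLDS at the diagonal setting**: every `S_log_v` exists (strict commutations).
[cite: MochizukiAbsTopIII2015, Cor 5.5 (iii) p. 131] -/
theorem diagonal_cor55ObservablesTS : (diagonal Vmod isArc C).Cor55ObservablesTS (diagonalTS Vmod isArc C) :=
  fun v => ⟨_, diagonal_isLogObservableTS Vmod isArc C v⟩

/-- **The PRINT-FAITHFUL Cor 5.5 (iv), first sentence (`Cor55LogWall`) FAILS at the diagonal setting** (with its `TS`-homotopies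
`diagonalTS`): the strict-commutation core of `D•_{≤2}` on `D•_{≤1}`, the strict-commutation observables `S_log⊞_v` AND `S_log_v`,
and the strict-commutation family of all co-verticial pairs of `D•⊢` are pairwise compatible.  With
`LogFrobeniusSetting.exists_cor55LogWall` (`LogFrobeniusLogWallTSNonVacuity.lean`) the typed print-faithful log-wall is INDEPENDENT
of the interface; calibration of typed statements only (the diagonal setting is degenerate).
[cite: MochizukiAbsTopIII2015, Cor 5.5 (iv) p. 131] -/
theorem diagonal_not_cor55LogWall : ¬ (diagonal Vmod isArc C).Cor55LogWall (diagonalTS Vmod isArc C) := fun h =>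
  h ⟨diagonalObsFamily Vmod isArc C (DVertex.InFirstRows 1) .core,
    diagonalObsFamily_terminal Vmod isArc C (DVertex.InFirstRows 1) .core, diagonalFamily Vmod isArc C,
    fun v => diagonalObsFamily Vmod isArc C (DVertex.InFirstRows 2) (.nplus v),
    fun v => diagonalObsFamily Vmod isArc C (InPortionThree v) (.nv v), diagonal_isCore_core Vmod isArc C,
    diagonalObsFamily_compatibleIn Vmod isArc C (DVertex.InFirstRows 1) .core,
    fun v => ⟨⟨diagonal_isLogObservablePlus Vmod isArc C v,
        diagonalObsFamily_compatibleIn Vmod isArc C (DVertex.InFirstRows 2) (.nplus v)⟩,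
      ⟨diagonal_isLogObservableTS Vmod isArc C v,
        diagonalObsFamily_compatibleIn Vmod isArc C (InPortionThree v) (.nv v)⟩⟩⟩

/-- **Over every index set there are a setting and `TS`-homotopies at which the typed Cor 5.5 (iii) (both halves) holds and the
typed print-faithful Cor 5.5 (iv), first sentence, fails** — the diagonal setting on any large category.
[cite: MochizukiAbsTopIII2015, Cor 5.5 (iv) p. 131] -/
theorem exists_cor55ObservablesTS_and_not_cor55LogWall :
    ∃ (L : LogFrobeniusSetting Vmod isArc) (T : L.TSHomotopies),
      L.X = C ∧ L.Cor55Observables ∧ L.Cor55ObservablesTS T ∧ ¬ L.Cor55LogWall T :=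
  ⟨diagonal Vmod isArc C, diagonalTS Vmod isArc C, rfl, diagonal_cor55Observables Vmod isArc C,
    diagonal_cor55ObservablesTS Vmod isArc C, diagonal_not_cor55LogWall Vmod isArc C⟩

end LogFrobeniusSetting

end Literature.AnabelianGeometry.AbsoluteAnabelian
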